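import Literature.Computability.AlgebraicComplexity.CombinatorialDegeneration
import Literature.Computability.AlgebraicComplexity.TruncatedPolynomialBorderRank
import Literature.Computability.AlgebraicComplexity.FlatteningRank
import Literature.Computability.AlgebraicComplexity.BigCoppersmithWinogradProofs
import Literature.Computability.AlgebraicComplexity.AsymptoticRankBorderRank
import Literature.Barriers.MatrixMultiplication.UniversalMethodBarrierDegenerationPow
import Literature.Barriers.MatrixMultiplication.UniversalMethodBarrierAsymptoticRank
import Literature.Barriers.MatrixMultiplication.UniversalMethodBarrierCwCore
import Literature.Barriers.MatrixMultiplication.UnstableTensorBarrierProofs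
import Summits.MatrixMultiplication.MatrixMultiplication.Theorems.SaturationLadderCurvilinearDominationCw
import HarnessLib
import Mathlib.RingTheory.RootsOfUnity.Complex

/-!
# Route `SaturationLadder` — the curvilinear pencil is closed under Kronecker products:
# `Str(K[t]/(t^{ab})) ⊵ Str(K[t]/(t^a)) ⊠ Str(K[t]/(t^b))`, hence `P_{(q+2)^N} ⊵ CW_q^{⊠N}` with the
# exact threshold `P_M ⊵ CW_q^{⊠N} ⟺ M ≥ (q+2)^N`
# (decomp-mm lens 1 «grading / quantitative ladder», gen 42; support kernel beneath crux `SubexpSaturation`,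
# stmt-MatrixMultiplication-25909; sequel to `SaturationLadderCurvilinearDomination(Cw)` of gen 41)

PROVED, 0 sorry; no definitions, no instances, no named facts.  `P_m := truncPolyMulTensor K m`
(`P_m z x y = [x + y = z]`, the structure tensor of `K[t]/(t^m)`, BCS Ex. (15.20)), `CW_q := bigCwTensor`,
`⊠ := kroneckerTensor`, `PolyDegeneratesTo` = BCS (15.19) / Alman §2.4, `IsCombDegeneration` /
`BCS1997_prop_15_30` = BCS Def. (15.29) / Prop. (15.30).

THE DEGENERATION (§1–2).  Write an exponent `x < ab` in base `b`, `x = b·x₁ + x₀`.  On the support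
`Φ = {x + y = z}` of `P_{ab}` the weights `a(z) = −(z mod b)`, `b(x) = x mod b`, `c(y) = y mod b` sum to
`x₀ + y₀ − (x + y)₀`, which is `0` when the low digits do not carry (`x₀ + y₀ < b`) and `b > 0` when they do:
a combinatorial degeneration `Ψ ⊴ Φ` onto the carry-free part `Ψ = {x + y = z, x₀ + y₀ < b}` (BCS Def.
(15.29)(2)).  Under the digit bijection `Fin a × Fin b ≃ Fin (ab)`, `(x₁, x₀) ↦ b x₁ + x₀` (Mathlib's
`finProdFinEquiv`), `Ψ` is exactly the support `{x₁ + y₁ = z₁} × {x₀ + y₀ = z₀}` of `P_a ⊠ P_b`, all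
coefficients `1`: `P_{ab} ⊵ P_a ⊠ P_b` over every commutative semiring (BCS Prop. (15.30)).  Read on the
algebra, the same torus action `t^x ↦ ε^{x mod b} t^x` contracts `K[t]/(t^{ab})` to `K[X,Y]/(X^a, Y^b)`
(`Y = εt`, `X = t^b`, `Y^b = ε^b X`: the flat family `(Y^b − ε^b X, X^a)` aligning the monomial complete
intersection with a curvilinear scheme); by Bläser–Lysikov 2016, Thm. 6, tensor and algebraic degeneration
agree for unital algebras, so §2 says exactly that `K[X_1,…,X_N]/(X_1^m,…,X_N^m)` is a degeneration of the
curvilinear algebra `K[t]/(t^{m^N})`; here it is only used on structure tensors.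

THE THEOREMS.
* `isCombDegeneration_truncPoly_carryFree`, `truncPolyMulTensor_polyDegeneratesTo_kronecker` — `P_{ab} ⊵ P_a ⊠ P_b`;
* `truncPolyMulTensor_pow_polyDegeneratesTo_kroneckerPow` — `P_{m^N} ⊵ P_m^{⊠N}` (iterate along
  `P_{m^N·m} ⊵ P_{m^N} ⊠ P_m`);
* `polyDegeneratesTo_truncPolyMulTensor_kronecker` — the class `{s : ∃ M, P_M ⊵ s}` is closed under `⊠`
  (with `M` multiplicative);
* `truncPolyMulTensor_pow_polyDegeneratesTo_kroneckerPow_splitCw` (every commutative semiring),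
  `…_bigCwTensor` (fields with `i² = −1`, `2 ≠ 0`), `…_bigCwTensor_complex` — `P_{(q+2)^N} ⊵ L_q^{⊠N}`,
  `CW_q^{⊠N}`, composing with gen 41's `P_{q+2} ⊵ L_q ≅ CW_q`;
* `polyDegeneratesTo_truncPolyMulTensor_of_bigCwTensor_pow` — SINGLE-TENSOR UNIVERSALITY: whatever a
  Kronecker power `CW_q^{⊠N}` degenerates to (a laser-method certificate in the degeneration framework is such
  a degeneration, onto a direct sum of matrix multiplication tensors) is a degeneration of the ONE tensor
  `P_{(q+2)^N}`, of the same border rank `(q+2)^N`;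
* `truncPolyMulTensor_polyDegeneratesTo_kroneckerPow_bigCwTensor_iff` — the EXACT THRESHOLD over `ℂ`:
  `P_M ⊵ CW_q^{⊠N} ⟺ (q+2)^N ≤ M` (`⇐`: the above and `P_M ≥ P_{M'}` for `M' ≤ M`; `⇒`:
  `(q+2)^N = ζ⁽¹⁾(CW_q)^N = ζ⁽¹⁾(CW_q^{⊠N}) ≤ R̃(CW_q^{⊠N}) ≤ R̃(P_M) ≤ R̲(P_M) = M`);
* `asymptoticRank_…` — the asymptotic-rank shadows.

WHY (memo `decomp-mm-lens-1/gen42/NODE-SaturationLadder-g42.md` §1–2).  Gen 41 put every base tensor of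
the lineage's unique-usage map below a single `P_m` of the same format; this file closes the curvilinear
pencil `{P_M}` under the one operation the laser method adds — Kronecker powers — so the base family of the
whole single-scale additive laser class for item 25909 (floor `c⋆ = 1.0645958`, proved `c₂ = 1.0650531`)
collapses to the pencil itself, ONE tensor per border rank, no powers: a `CW_q^{⊠N}`-certificate of value
`V` is a `P_{(q+2)^N}`-certificate of the same value and the same border rank.  The threshold theorem says
the pencil index cannot be lowered.  Not a statement about `ω`; Strassen's spectrum `Δ(K[t]/(t^M)) =
[z(M), M]`, `z(M) ≈ 0.84 M`, shows the pencil is not spectrally barred from `ω = 2` (CVZ 2021 §1.4).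
[cite: BurgisserClausenShokrollahi1997, Def. (15.29), Prop. (15.30), Ex. (15.20); Alman2021, §2.4;
BlaserLysikov2016, Thm. 6, §3.4; ChristandlVranaZuiddam2021, Thm. 22, §1.4; ChristandlVranaZuiddam2023, Example 1.4]
-/

set_option linter.dupNamespace false

noncomputable section

open scoped BigOperators Polynomial

namespace Summit.MatrixMultiplication.MatrixMultiplication.Theorems.SaturationLadderCurvilinearKronecker

open Literature.Computability.AlgebraicComplexity Literature.Barriers.MatrixMultiplication
open Summit.MatrixMultiplication.MatrixMultiplication.Theorems.SaturationLadderCurvilinearDomination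
open Summit.MatrixMultiplication.MatrixMultiplication.Theorems.SaturationLadderCurvilinearDominationCw

universe u

/-! ## 0. Carries in base `b` -/

section Carry

/-- No carry: `(x + y) mod b = x mod b + y mod b` when `x mod b + y mod b < b`. [folklore] -/
theorem add_mod_of_noCarry {b x y : ℕ} (h : x % b + y % b < b) : (x + y) % b = x % b + y % b := by
  rw [Nat.add_mod, Nat.mod_eq_of_lt h]

/-- Carry: `(x + y) mod b + b = x mod b + y mod b` when `b ≤ x mod b + y mod b`. [folklore] -/
theorem add_mod_of_carry {b x y : ℕ} (h : b ≤ x % b + y % b) : (x + y) % b + b = x % b + y % b := by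
  rcases Nat.eq_zero_or_pos b with rfl | hb
  · simp [Nat.mod_zero]
  · have hx := Nat.mod_lt x hb
    have hy := Nat.mod_lt y hb
    rw [Nat.add_mod, Nat.mod_eq_sub_mod h, Nat.mod_eq_of_lt (by omega)]
    omega

/-- The digit bijection `Fin a × Fin b ≃ Fin (ab)` of Mathlib sends `(x₁, x₀) ↦ x₀ + b x₁`. [folklore] -/
theorem finProdFinEquiv_val {a b : ℕ} (x : Fin a × Fin b) :
    ((finProdFinEquiv x : Fin (a * b)) : ℕ) = (x.2 : ℕ) + b * (x.1 : ℕ) := rfl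

/-- In digits: `x + y = z` without carry in the low digit iff the digits add separately. [folklore] -/
theorem carryFree_iff {a b : ℕ} (p q r : Fin a × Fin b) :
    ((q.2 : ℕ) + b * q.1 + ((r.2 : ℕ) + b * r.1) = (p.2 : ℕ) + b * p.1 ∧
        ((q.2 : ℕ) + b * q.1) % b + ((r.2 : ℕ) + b * r.1) % b < b) ↔
      ((q.1 : ℕ) + r.1 = p.1 ∧ (q.2 : ℕ) + r.2 = p.2) := by
  have hq := q.2.isLt
  have hr := r.2.isLt
  have hp := p.2.isLt
  rw [Nat.add_mul_mod_self_left, Nat.add_mul_mod_self_left, Nat.mod_eq_of_lt hq, Nat.mod_eq_of_lt hr]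
  constructor
  · rintro ⟨E, hc⟩
    -- uniqueness of the base-`b` digits of `(q₀ + r₀) + b (q₁ + r₁) = p₀ + b p₁`
    have E' : ((q.2 : ℕ) + r.2) + b * (q.1 + r.1) = (p.2 : ℕ) + b * p.1 := by rw [Nat.mul_add]; omega
    have hb : 0 < b := by omega
    have hmod : (((q.2 : ℕ) + r.2) + b * (q.1 + r.1)) % b = ((p.2 : ℕ) + b * p.1) % b := by rw [E']
    rw [Nat.add_mul_mod_self_left, Nat.add_mul_mod_self_left, Nat.mod_eq_of_lt hc,
      Nat.mod_eq_of_lt hp] at hmod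
    have hdiv : (((q.2 : ℕ) + r.2) + b * (q.1 + r.1)) / b = ((p.2 : ℕ) + b * p.1) / b := by rw [E']
    rw [Nat.add_mul_div_left _ _ hb, Nat.add_mul_div_left _ _ hb, Nat.div_eq_of_lt hc,
      Nat.div_eq_of_lt hp] at hdiv
    exact ⟨by simpa using hdiv, hmod⟩
  · rintro ⟨h1, h2⟩
    refine ⟨?_, by omega⟩
    rw [← h1, ← h2, Nat.mul_add]
    omega

end Carry

/-! ## 1. The carry-free part of the support of `Str(K[t]/(t^{ab}))` is a combinatorial degeneration -/

section CombDeg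

/-- **The weights.** On the support `Φ = {(z,x,y) : x + y = z}` of `P_{ab}` (finest blocking, coordinates
`(output, input, input)`) put `a(z) = −(z mod b)`, `b(x) = x mod b`, `c(y) = y mod b`.  On `Φ` the sum is
`x mod b + y mod b − (x + y) mod b`: `= 0` on the carry-free part `Ψ = {x + y = z, x mod b + y mod b < b}`
and `= b > 0` on `Φ ∖ Ψ` (a carry).  So `Ψ ⊴ Φ` in the sense of BCS Def. (15.29)(2).
[cite: BurgisserClausenShokrollahi1997, Def. (15.29)(2), Ex. (15.20)] -/
theorem isCombDegeneration_truncPoly_carryFree (a b : ℕ) :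
    IsCombDegeneration
      (Finset.univ.filter fun s : Fin (a * b) × Fin (a * b) × Fin (a * b) =>
        (s.2.1 : ℕ) + (s.2.2 : ℕ) = (s.1 : ℕ))
      (Finset.univ.filter fun s : Fin (a * b) × Fin (a * b) × Fin (a * b) =>
        (s.2.1 : ℕ) + (s.2.2 : ℕ) = (s.1 : ℕ) ∧ (s.2.1 : ℕ) % b + (s.2.2 : ℕ) % b < b) := by
  refine ⟨fun s hs => ?_, fun z => -((((z : ℕ) % b : ℕ)) : ℤ), fun x => (((x : ℕ) % b : ℕ) : ℤ),
    fun y => (((y : ℕ) % b : ℕ) : ℤ), ?_, ?_⟩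
  · simp only [Finset.mem_filter, Finset.mem_univ, true_and] at hs ⊢
    exact hs.1
  · rintro ⟨z, x, y⟩ hs
    simp only [Finset.mem_filter, Finset.mem_univ, true_and] at hs
    obtain ⟨hsum, hc⟩ := hs
    have key : (z : ℕ) % b = (x : ℕ) % b + (y : ℕ) % b := by
      rw [← hsum]; exact add_mod_of_noCarry hc
    simp only
    generalize (z : ℕ) % b = rz at key ⊢
    generalize (x : ℕ) % b = rx at key ⊢
    generalize (y : ℕ) % b = ry at key ⊢
    omega
  · rintro ⟨z, x, y⟩ hs hns
    simp only [Finset.mem_filter, Finset.mem_univ, true_and] at hs hns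
    have hc : b ≤ (x : ℕ) % b + (y : ℕ) % b := by
      by_contra hlt
      exact hns ⟨hs, by omega⟩
    have key : (z : ℕ) % b + b = (x : ℕ) % b + (y : ℕ) % b := by
      rw [← hs]; exact add_mod_of_carry hc
    have hb : 0 < b := by
      rcases Nat.eq_zero_or_pos b with hb0 | hb
      · exact absurd z.isLt (by simp [hb0])
      · exact hb
    simp only
    generalize (z : ℕ) % b = rz at key ⊢
    generalize (x : ℕ) % b = rx at key ⊢
    generalize (y : ℕ) % b = ry at key ⊢
    omega

end CombDeg

/-! ## 2. `Str(K[t]/(t^{ab})) ⊵ Str(K[t]/(t^a)) ⊠ Str(K[t]/(t^b))` -/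

section Degeneration

variable (K : Type u) [CommSemiring K]

/-- **`P_{ab} ⊵ P_a ⊠ P_b` over every commutative semiring.**  BCS Prop. (15.30) applied to the carry-free
combinatorial degeneration `isCombDegeneration_truncPoly_carryFree` (monomially: `t^x ↦ ε^{x mod b} t^x` on
both inputs, `ε^{−(z mod b)}` on the output), followed by the digit relabelling `Fin a × Fin b ≃ Fin (ab)`,
`(x₁, x₀) ↦ b x₁ + x₀`, under which the carry-free support `{x + y = z, x₀ + y₀ < b}` becomes
`{x₁ + y₁ = z₁} × {x₀ + y₀ = z₀} = supp (P_a ⊠ P_b)`, all entries `1`.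
[cite: BurgisserClausenShokrollahi1997, Prop. (15.30), Ex. (15.20); Alman2021, §2.4] -/
theorem truncPolyMulTensor_polyDegeneratesTo_kronecker (a b : ℕ) :
    PolyDegeneratesTo (truncPolyMulTensor K (a * b))
      (kroneckerTensor (truncPolyMulTensor K a) (truncPolyMulTensor K b)) := by
  classical
  have hS : ∀ z x y : Fin (a * b), truncPolyMulTensor K (a * b) z x y ≠ 0 →
      (id z, id x, id y) ∈ (Finset.univ.filter fun s : Fin (a * b) × Fin (a * b) × Fin (a * b) =>
        (s.2.1 : ℕ) + (s.2.2 : ℕ) = (s.1 : ℕ)) := by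
    intro z x y hne
    simp only [id, Finset.mem_filter, Finset.mem_univ, true_and]
    by_contra hc
    exact hne (by rw [truncPolyMulTensor_apply, if_neg hc])
  have h := (BCS1997_prop_15_30 (truncPolyMulTensor K (a * b)) id id id _ _ hS
    (isCombDegeneration_truncPoly_carryFree a b)).reindex
      (finProdFinEquiv : Fin a × Fin b ≃ Fin (a * b)) (finProdFinEquiv : Fin a × Fin b ≃ Fin (a * b))
      (finProdFinEquiv : Fin a × Fin b ≃ Fin (a * b))
  convert h using 1
  funext p q r
  simp only [kroneckerTensor_apply, blockSubtensor_apply, truncPolyMulTensor_apply, id,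
    Finset.mem_filter, Finset.mem_univ, true_and, finProdFinEquiv_val]
  by_cases H : (q.1 : ℕ) + r.1 = p.1 ∧ (q.2 : ℕ) + r.2 = p.2
  · have H' := (carryFree_iff p q r).2 H
    rw [if_pos H', if_pos H'.1, if_pos H.1, if_pos H.2, mul_one]
  · rw [if_neg (mt (carryFree_iff p q r).1 H)]
    by_cases H1 : (q.1 : ℕ) + r.1 = p.1
    · rw [if_pos H1, if_neg (fun H2 => H ⟨H1, H2⟩), mul_zero]
    · rw [if_neg H1, zero_mul]

/-- `P_M ≥ P_{M'}` for `M' ≤ M` (restrict to exponents `< M'`). [cite: BurgisserClausenShokrollahi1997, Ex. (15.20)] -/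
theorem truncPolyMulTensor_restrictsTo_of_le {M M' : ℕ} (h : M' ≤ M) :
    TensorRestrictsTo (truncPolyMulTensor K M) (truncPolyMulTensor K M') := by
  classical
  have e : truncPolyMulTensor K M' = fun z x y =>
      truncPolyMulTensor K M (Fin.castLE h z) (Fin.castLE h x) (Fin.castLE h y) := by
    funext z x y
    by_cases hc : (x : ℕ) + y = z
    · simp [truncPolyMulTensor_apply, Fin.val_castLE, hc]
    · simp [truncPolyMulTensor_apply, Fin.val_castLE, hc]
  rw [e]
  exact tensorRestrictsTo_precomp _ _ _ _

/-- **`P_{m^N} ⊵ P_m^{⊠N}`**: iterate `P_{m^N·m} ⊵ P_{m^N} ⊠ P_m ⊵ P_m^{⊠N} ⊠ P_m ≥ P_m^{⊠(N+1)}`.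
[cite: BurgisserClausenShokrollahi1997, Prop. (15.30), Lemma (15.24); Alman2021, §2.4] -/
theorem truncPolyMulTensor_pow_polyDegeneratesTo_kroneckerPow (m N : ℕ) :
    PolyDegeneratesTo (truncPolyMulTensor K (m ^ N)) (kroneckerPow (truncPolyMulTensor K m) N) := by
  classical
  induction N with
  | zero =>
    show PolyDegeneratesTo (truncPolyMulTensor K 1) (kroneckerPow (truncPolyMulTensor K m) 0)
    refine TensorRestrictsTo.polyDegeneratesTo ⟨fun _ _ => 1, fun _ _ => 1, fun _ _ => 1, ?_⟩
    intro a' b' c'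
    simp [kroneckerPow_apply]
  | succ N ih =>
    have hA := truncPolyMulTensor_polyDegeneratesTo_kronecker K (m ^ N) m
    have h2 : PolyDegeneratesTo
        (kroneckerTensor (truncPolyMulTensor K (m ^ N)) (truncPolyMulTensor K m))
        (kroneckerTensor (kroneckerPow (truncPolyMulTensor K m) N) (truncPolyMulTensor K m)) :=
      ih.kronecker (TensorRestrictsTo.refl _).polyDegeneratesTo
    have h3 : TensorRestrictsTo
        (kroneckerTensor (kroneckerPow (truncPolyMulTensor K m) N) (truncPolyMulTensor K m))
        (kroneckerPow (truncPolyMulTensor K m) (N + 1)) := by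
      have e : kroneckerPow (truncPolyMulTensor K m) (N + 1) = fun a b c =>
          kroneckerTensor (kroneckerPow (truncPolyMulTensor K m) N) (truncPolyMulTensor K m)
            (Fin.init a, a (Fin.last N)) (Fin.init b, b (Fin.last N)) (Fin.init c, c (Fin.last N)) := by
        funext a b c
        simp only [kroneckerPow_apply, kroneckerTensor_apply, Fin.prod_univ_castSucc, Fin.init]
      rw [e]
      exact tensorRestrictsTo_precomp _ _ _ _
    rw [pow_succ]
    exact (hA.trans h2).trans_restrictsTo h3

/-- **The curvilinear pencil is closed under `⊠`**: `P_a ⊵ s`, `P_b ⊵ s' ⇒ P_{ab} ⊵ s ⊠ s'`.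
[cite: BurgisserClausenShokrollahi1997, Prop. (15.30); Alman2021, §2.4] -/
theorem polyDegeneratesTo_truncPolyMulTensor_kronecker {ι κ μ ι' κ' μ' : Type*}
    {s : ι → κ → μ → K} {s' : ι' → κ' → μ' → K} {a b : ℕ}
    (hs : PolyDegeneratesTo (truncPolyMulTensor K a) s) (hs' : PolyDegeneratesTo (truncPolyMulTensor K b) s') :
    PolyDegeneratesTo (truncPolyMulTensor K (a * b)) (kroneckerTensor s s') := by
  classical
  exact (truncPolyMulTensor_polyDegeneratesTo_kronecker K a b).trans (hs.kronecker hs')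

/-- **`P_{(q+2)^N} ⊵ L_q^{⊠N}`** (the split big Coppersmith–Winograd tensor of gen 41), every `q`, `N`,
every commutative semiring. [cite: BurgisserClausenShokrollahi1997, Prop. (15.30), Ex. (15.20); BlaserLysikov2016, §3.4] -/
theorem truncPolyMulTensor_pow_polyDegeneratesTo_kroneckerPow_splitCw (q N : ℕ) :
    PolyDegeneratesTo (truncPolyMulTensor K ((q + 2) ^ N))
      (kroneckerPow (fun z x y : Fin (q + 2) =>
        if (x : ℕ) + y = z ∧ ((x : ℕ) = 0 ∨ (y : ℕ) = 0 ∨ (z : ℕ) = q + 1) then (1 : K) else 0) N) := by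
  classical
  exact (truncPolyMulTensor_pow_polyDegeneratesTo_kroneckerPow K (q + 2) N).trans
    (truncPolyMulTensor_kroneckerPow_polyDegeneratesTo_splitCw K q N)

end Degeneration

/-! ## 3. `P_{(q+2)^N} ⊵ CW_q^{⊠N}` and the exact threshold -/

section Cw

variable {F : Type u} [Field F]

/-- **`P_{(q+2)^N} ⊵ CW_q^{⊠N}`** over every field with `i² = −1` and `2 ≠ 0`.
[cite: BurgisserClausenShokrollahi1997, Prop. (15.30), Ex. (15.20); ChristandlVranaZuiddam2021, Thm. 22] -/
theorem truncPolyMulTensor_pow_polyDegeneratesTo_kroneckerPow_bigCwTensor {i : F} (hi : i * i = -1)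
    (h2 : (2 : F) ≠ 0) (q N : ℕ) :
    PolyDegeneratesTo (truncPolyMulTensor F ((q + 2) ^ N)) (kroneckerPow (bigCwTensor F q) N) := by
  classical
  exact (truncPolyMulTensor_pow_polyDegeneratesTo_kroneckerPow F (q + 2) N).trans
    (truncPolyMulTensor_kroneckerPow_polyDegeneratesTo_bigCwTensor hi h2 q N)

/-- **`Str(ℂ[t]/(t^{(q+2)^N})) ⊵ CW_q^{⊠N}`** for every `q`, `N`.
[cite: BurgisserClausenShokrollahi1997, Prop. (15.30), Ex. (15.20); ChristandlVranaZuiddam2021, Thm. 22] -/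
theorem truncPolyMulTensor_pow_polyDegeneratesTo_kroneckerPow_bigCwTensor_complex (q N : ℕ) :
    PolyDegeneratesTo (truncPolyMulTensor ℂ ((q + 2) ^ N)) (kroneckerPow (bigCwTensor ℂ q) N) :=
  truncPolyMulTensor_pow_polyDegeneratesTo_kroneckerPow_bigCwTensor Complex.I_mul_I two_ne_zero q N

/-- **Single-tensor universality of the curvilinear pencil for the laser class**: whatever a Kronecker power
`CW_q^{⊠N}` degenerates to is a degeneration of the one tensor `P_{(q+2)^N}` (of the same border rank).
[cite: BurgisserClausenShokrollahi1997, Prop. (15.30); Alman2021, §2.4] -/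
theorem polyDegeneratesTo_truncPolyMulTensor_of_bigCwTensor_pow {ι κ μ : Type*} {s : ι → κ → μ → ℂ}
    {q N : ℕ} (hs : PolyDegeneratesTo (kroneckerPow (bigCwTensor ℂ q) N) s) :
    PolyDegeneratesTo (truncPolyMulTensor ℂ ((q + 2) ^ N)) s := by
  classical
  exact (truncPolyMulTensor_pow_polyDegeneratesTo_kroneckerPow_bigCwTensor_complex q N).trans hs

/-- **Exact threshold: `P_M ⊵ CW_q^{⊠N} ⟺ (q+2)^N ≤ M`** over `ℂ`.  `⇐`: `P_M ≥ P_{(q+2)^N} ⊵ CW_q^{⊠N}`;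
`⇒`: `(q+2)^N = ζ⁽¹⁾(CW_q)^N = ζ⁽¹⁾(CW_q^{⊠N}) ≤ R̃(CW_q^{⊠N}) ≤ R̃(P_M) ≤ R̲(P_M) = M`.
[cite: BurgisserClausenShokrollahi1997, Prop. (15.30), Ex. (15.20), Lemma (15.27); ChristandlVranaZuiddam2023, Example 1.4; Alman2021, §4.1] -/
theorem truncPolyMulTensor_polyDegeneratesTo_kroneckerPow_bigCwTensor_iff (M q N : ℕ) :
    PolyDegeneratesTo (truncPolyMulTensor ℂ M) (kroneckerPow (bigCwTensor ℂ q) N) ↔ (q + 2) ^ N ≤ M := by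
  classical
  constructor
  · intro h
    have h1 : (((q + 2) ^ N : ℕ) : ℝ) ≤ asymptoticRank (kroneckerPow (bigCwTensor ℂ q) N) := by
      have := flatteningRank_le_asymptoticRank (kroneckerPow (bigCwTensor ℂ q) N)
      rwa [flatteningRank_kroneckerPow, flatteningRank_bigCwTensor] at this
    have h3 := asymptoticRank_le_of_polyDegeneratesTo h
    rcases Nat.eq_zero_or_pos M with rfl | hM
    · exfalso
      have h4 : asymptoticRank (truncPolyMulTensor ℂ 0) = 0 := asymptoticRank_eq_zero_of_isEmpty _
      have h5 : (1 : ℝ) ≤ (((q + 2) ^ N : ℕ) : ℝ) := by exact_mod_cast Nat.one_le_pow N (q + 2) (by omega)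
      linarith
    · have h4 : asymptoticRank (truncPolyMulTensor ℂ M) ≤ (M : ℝ) := by
        have := asymptoticRank_le_algBorderRank (truncPolyMulTensor ℂ M)
        rwa [algBorderRank_truncPolyMulTensor (Complex.isPrimitiveRoot_exp M hM.ne') hM] at this
      exact_mod_cast (h1.trans (h3.trans h4))
  · intro hM
    exact (truncPolyMulTensor_restrictsTo_of_le ℂ hM).polyDegeneratesTo.trans
      (truncPolyMulTensor_pow_polyDegeneratesTo_kroneckerPow_bigCwTensor_complex q N)

end Cw

/-! ## 4. Asymptotic rank -/

section AsymptoticRank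

variable (F : Type u) [Field F]

/-- `R̃(P_a ⊠ P_b) ≤ R̃(P_{ab})` over every field. [cite: BurgisserClausenShokrollahi1997, Prop. (15.30), (15.26)] -/
theorem asymptoticRank_kronecker_le_truncPolyMulTensor (a b : ℕ) :
    asymptoticRank (kroneckerTensor (truncPolyMulTensor F a) (truncPolyMulTensor F b)) ≤
      asymptoticRank (truncPolyMulTensor F (a * b)) :=
  asymptoticRank_le_of_polyDegeneratesTo (truncPolyMulTensor_polyDegeneratesTo_kronecker F a b)

/-- `R̃(CW_q^{⊠N}) ≤ R̃(Str(ℂ[t]/(t^{(q+2)^N})))`. [cite: BurgisserClausenShokrollahi1997, Prop. (15.30), (15.26)] -/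
theorem asymptoticRank_kroneckerPow_bigCwTensor_le_truncPolyMulTensor_complex (q N : ℕ) :
    asymptoticRank (kroneckerPow (bigCwTensor ℂ q) N) ≤ asymptoticRank (truncPolyMulTensor ℂ ((q + 2) ^ N)) :=
  asymptoticRank_le_of_polyDegeneratesTo
    (truncPolyMulTensor_pow_polyDegeneratesTo_kroneckerPow_bigCwTensor_complex q N)

end AsymptoticRank

end Summit.MatrixMultiplication.MatrixMultiplication.Theorems.SaturationLadderCurvilinearKronecker
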